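import Summits.CriticalPhenomena.PercolationContinuityZ3.Theorems.PercNearOneGluingNoHeavyQuantLightPairBlobForest
import HarnessLib

/-!
# QUANT lane R8, T-DEC: THE LIGHT GLUED PAIR JUST ABOVE THE ROOT GATE `q = 1/2` — a closed-form certificate by four ungated blob forests
# and one floor-tight gated blob forest for `T = (R¹[q](R^c[s]))²` on the explicit region `R_BFlow(c)` (`1/2 < q ≤ min(1/(2−s), 1/(1+s))`)

builds on p205010 (kernel theorem, internal audit signed; external expert review pending)

Support file (`--supports stmt-CriticalPhenomena-4575`), QUANT lane census seat prim-quant-census-2 (gen 77), rung R8 of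
`run/shared/lean/prim/quant/LADDER.md`.  Theorems only (no definition, no conjecture); standard axioms, no sorries.  Sequel of
`…QuantLightPairBlobForest` (pattern `M`, the upper-left strip) and `…QuantCatHullSmallGates` (`q ≤ 1/2`, two columns).

WHAT.  Pattern `H` of census-2 g77's exact LP map (memo `run/shared/lean/prim/quant/prim-quant-census-2-g77/CENSUS-PAIRMAP-G77.md`): the strip
just above `q = 1/2` (where p490773's two-column re-gating stops) is certified, for blob gates `s` not too small, by
  `T = w₂·[δ₁ ∗ blob(c+1, (T−1)/(c+1))] + w₄·[δ₂ ∗ blob(c, (T−2)/c)] + w₅·blob(c+1, T/(c+1)) + w₆·blob(c+2, T/(c+2)) + qs·gate_{q(2−s)}(δ₁ ∗ blob(2c+1, s/(2−s)))`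
(`T = 2q(1+cs)` the mean, floor `y = qs`; the last column is FLOOR-TIGHT: its blob marginal is `q(2−s)·s/(2−s) = qs`, and `q(2−s)·(1 − s/(2−s)) = 2q(1−s)`),
  `w₄ = q²(1−s)²c/(c+2−T)`, `w₅ = 2q(1−q)s(c+1)/T`, `w₂ = 2q(1−s)(1−q−qs)(c+1)/(c+2−T)`,
  `w₆ = (c+2)q(1−s)[2qs(c+2−T) − 2(1−q−qs)(T−1) − q(1−s)(T−2)]/(T(c+2−T))`.
Valid EXACTLY on `R_BFlow(c) = { 1 ≤ c, 1/2 < q, 0 < s < 1, T ≤ c+1, q(2−s) ≤ 1, q(1+s) ≤ 1, 2(1−q) ≤ cqs, 2qs(c+2−T) ≥ 2(1−q−qs)(T−1) + q(1−s)(T−2) }`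
(exact scan, 0 mismatches between the inequality list, the certificate checker and the LP on 17 146 grid points, `c ≤ 20`); e.g. `c = 4`:
`q = .55, s ∈ [.4, .8]`; `q = .6, s ∈ [.3, .65]`; `q = .65, s ∈ [.45, .5]`.  The floor is light automatically (`qs ≤ s/(1+s) < 1/2`).
* `lpT_eq_bfLowMix` (pointwise identity off the poles); **`lpT_inGatedCatHull_bfLow`**; `_below`, `sdec_lpT_bfLow`, **`treeBuiltCatHull_lpT_bfLow`**.
HONEST STATUS.  Instances on an explicit region only; `TreeBuiltCatHullLight`, `CatPairLight`, `SiblingStep`, `FarTreeRow` remain OPEN; RATE class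
log\* / honest sentence of `run/shared/lean/prim/quant/README.md` unchanged.  [this work]; `lpT`: prim-quant-census-2 g76.  Nothing here is cited as
a published result.  The gluing rows served [cite: KozmaNitzan2024, Conjecture 3 (p. 15)]; product measure [cite: Grimmett1999, §1.3 p. 10].
-/

noncomputable section

open scoped BigOperators

namespace Summit.CriticalPhenomena.PercolationContinuityZ3.Theorems
namespace Quant
namespace LawDec

open Finset

/-! ### The closed-form identity -/

/-- value form of a gated blob-forest column `gate (blobLaw [(a, g), (1, 1)]) u`. [this work] -/
theorem gate_blobLaw_pair_sure_apply (a : ℕ) (g u : ℝ) (h : ℕ) :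
    gate (blobLaw [(a, g), (1, 1)]) u h = u * ((1 - g) * pointLaw 1 h + g * pointLaw (a + 1) h) + (1 - u) * pointLaw 0 h := by
  rw [gate_apply, blobLaw_pair_sure_apply, show (if h = 0 then (1 : ℝ) else 0) = pointLaw 0 h from (pointLaw_apply 0 h).symm]

/-- **THE IDENTITY OF PATTERN `H`** (pointwise; `c ≠ 0`, off the poles `T ≠ 0`, `T ≠ c+2`, `s ≠ 2`; `T = 2q(1+cs)`). [this work] -/
theorem lpT_eq_bfLowMix (c : ℕ) (q s : ℝ) (hc0 : (c : ℝ) ≠ 0) (hT0 : 2 * q * (1 + c * s) ≠ 0) (hV : (c : ℝ) + 2 - 2 * q * (1 + c * s) ≠ 0)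
    (hS : 2 - s ≠ 0) (h : ℕ) :
    lpT c q s h =
      (2 * q * (1 - s) * (1 - q - q * s) * (c + 1) / (c + 2 - 2 * q * (1 + c * s))) *
          blobLaw [(c + 1, (2 * q * (1 + c * s) - 1) / (c + 1)), (1, 1)] h +
        (q ^ 2 * (1 - s) ^ 2 * c / (c + 2 - 2 * q * (1 + c * s))) * blobLaw [(c, (2 * q * (1 + c * s) - 2) / c), (2, 1)] h +
        (2 * q * (1 - q) * s * (c + 1) / (2 * q * (1 + c * s))) * blobLaw [(c + 1, 2 * q * (1 + c * s) / (c + 1))] h +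
        ((c + 2) * q * (1 - s) *
              (2 * q * s * (c + 2 - 2 * q * (1 + c * s)) - 2 * (1 - q - q * s) * (2 * q * (1 + c * s) - 1) -
                q * (1 - s) * (2 * q * (1 + c * s) - 2)) /
            (2 * q * (1 + c * s) * (c + 2 - 2 * q * (1 + c * s)))) *
          blobLaw [(c + 2, 2 * q * (1 + c * s) / (c + 2))] h +
        (q * s) * gate (blobLaw [(2 * c + 1, s / (2 - s)), (1, 1)]) (q * (2 - s)) h := by
  have hc1 : (c : ℝ) + 1 ≠ 0 := by positivity
  have hc2 : (c : ℝ) + 2 ≠ 0 := by positivity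
  rw [lpT_apply, blobLaw_pair_sure_apply, blobLaw_pair_sure_apply, blobLaw_one_apply, blobLaw_one_apply, gate_blobLaw_pair_sure_apply,
    show c + 1 + 1 = c + 2 by ring, show 2 * c + 1 + 1 = 2 * c + 2 by ring]
  generalize eT : 2 * q * (1 + (c : ℝ) * s) = T at hT0 hV ⊢
  generalize eV : (c : ℝ) + 2 - T = V at hV ⊢
  generalize eS : (2 : ℝ) - s = S at hS ⊢
  field_simp
  subst eV eT
  -- restore `s = 2 − S`
  have es : s = 2 - S := by linarith
  subst es
  ring

/-! ### Membership on the region `R_BFlow(c)` -/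

/-- **THE LIGHT GLUED PAIR IS IN THE HULL ON `R_BFlow(c)`**: for `1 ≤ c`, `1/2 < q`, `0 < s < 1` with `T := 2q(1+cs) ≤ c + 1`, `q(2−s) ≤ 1`,
`q(1+s) ≤ 1`, `2(1−q) ≤ c·qs` and `2(1−q−qs)(T−1) + q(1−s)(T−2) ≤ 2qs(c+2−T)`: `InGatedCatHull (qs) T (2c+2) (lpT c q s)`. [this work] -/
theorem lpT_inGatedCatHull_bfLow (c : ℕ) (q s : ℝ) (hc : 1 ≤ c) (hq : 1 / 2 < q) (hs0 : 0 < s) (hs1 : s < 1)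
    (hT : 2 * q * (1 + c * s) ≤ c + 1) (hu : q * (2 - s) ≤ 1) (hw2 : q * (1 + s) ≤ 1) (hE : 2 * (1 - q) ≤ c * (q * s))
    (hw6 : 2 * (1 - q - q * s) * (2 * q * (1 + c * s) - 1) + q * (1 - s) * (2 * q * (1 + c * s) - 2)
      ≤ 2 * q * s * (c + 2 - 2 * q * (1 + c * s))) :
    InGatedCatHull (q * s) (2 * q * (1 + c * s)) (2 * c + 2) (lpT c q s) := by
  have hc0' : (0 : ℝ) < c := by exact_mod_cast hc
  have hc0 : (c : ℝ) ≠ 0 := hc0'.ne'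
  have hq0 : 0 < q := by linarith
  have hq1 : q < 1 := by nlinarith
  have hy0 : 0 < q * s := by nlinarith
  have hy1 : q * s < 1 := by nlinarith
  set T := 2 * q * (1 + c * s) with hTdef
  have hT1 : 1 < T := by
    have : 0 < 2 * q * (c * s) := by positivity
    rw [hTdef]; nlinarith
  have hV : 0 < (c : ℝ) + 2 - T := by linarith
  have hTpos : 0 < T := by linarith
  -- columns 1–4: ungated blob forests at floor `qs`, mean `T`, top `2c+2`
  have m2 : InGatedCatHull (q * s) T (2 * c + 2) (blobLaw [(c + 1, (T - 1) / (c + 1)), (1, 1)]) := by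
    have hc1 : (0 : ℝ) < c + 1 := by positivity
    have g := inGatedCatHull_blobLaw (q * s) hy0 hy1 [(c + 1, (T - 1) / (c + 1)), (1, 1)] (fun p hp => by
      simp only [List.mem_cons, List.not_mem_nil, or_false] at hp
      rcases hp with rfl | rfl
      · refine ⟨?_, ?_⟩
        · show q * s ≤ (T - 1) / (c + 1)
          rw [le_div_iff₀ hc1, hTdef]
          have : 0 ≤ (c - 1 : ℝ) * (q * s) := mul_nonneg (by linarith [show (1 : ℝ) ≤ c by exact_mod_cast hc]) hy0.le
          nlinarith
        · show (T - 1) / (c + 1) ≤ 1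
          rw [div_le_one hc1]; linarith
      · exact ⟨hy1.le, le_rfl⟩) (M := 2 * c + 2) (by simp only [blobTop]; omega)
    have e : blobMean [(c + 1, (T - 1) / (c + 1)), (1, 1)] = T := by
      simp only [blobMean]; push_cast; field_simp; ring
    rwa [e] at g
  have m4 : InGatedCatHull (q * s) T (2 * c + 2) (blobLaw [(c, (T - 2) / c), (2, 1)]) := by
    have g := inGatedCatHull_blobLaw (q * s) hy0 hy1 [(c, (T - 2) / c), (2, 1)] (fun p hp => by
      simp only [List.mem_cons, List.not_mem_nil, or_false] at hp
      rcases hp with rfl | rfl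
      · refine ⟨?_, ?_⟩
        · rw [le_div_iff₀ hc0']; rw [hTdef]; nlinarith
        · rw [div_le_one hc0']; linarith
      · exact ⟨hy1.le, le_rfl⟩) (M := 2 * c + 2) (by simp only [blobTop]; omega)
    have e : blobMean [(c, (T - 2) / c), (2, 1)] = T := by simp only [blobMean]; push_cast; field_simp; ring
    rwa [e] at g
  have m5 : InGatedCatHull (q * s) T (2 * c + 2) (blobLaw [(c + 1, T / (c + 1))]) := by
    have hc1 : (0 : ℝ) < c + 1 := by positivity
    have g := inGatedCatHull_blobLaw (q * s) hy0 hy1 [(c + 1, T / (c + 1))] (fun p hp => by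
      simp only [List.mem_cons, List.not_mem_nil, or_false] at hp
      subst hp
      refine ⟨?_, ?_⟩
      · show q * s ≤ T / (c + 1)
        rw [le_div_iff₀ hc1, hTdef]; nlinarith
      · show T / (c + 1) ≤ 1
        rw [div_le_one hc1]; linarith) (M := 2 * c + 2) (by simp only [blobTop]; omega)
    have e : blobMean [(c + 1, T / (c + 1))] = T := by simp only [blobMean]; push_cast; field_simp; ring
    rwa [e] at g
  have m6 : InGatedCatHull (q * s) T (2 * c + 2) (blobLaw [(c + 2, T / (c + 2))]) := by
    have hc2 : (0 : ℝ) < c + 2 := by positivity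
    have g := inGatedCatHull_blobLaw (q * s) hy0 hy1 [(c + 2, T / (c + 2))] (fun p hp => by
      simp only [List.mem_cons, List.not_mem_nil, or_false] at hp
      subst hp
      refine ⟨?_, ?_⟩
      · show q * s ≤ T / (c + 2)
        rw [le_div_iff₀ hc2, hTdef]; nlinarith
      · show T / (c + 2) ≤ 1
        rw [div_le_one hc2]; linarith) (M := 2 * c + 2) (by simp only [blobTop]; omega)
    have e : blobMean [(c + 2, T / (c + 2))] = T := by simp only [blobMean]; push_cast; field_simp; ring
    rwa [e] at g
  -- column 5: the floor-tight gated blob forest `gate_{q(2−s)}(δ₁ ∗ blob(2c+1, s/(2−s)))`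
  have hS : 0 < 2 - s := by linarith
  have hg7 : 0 < s / (2 - s) := div_pos hs0 hS
  have hg7' : s / (2 - s) < 1 := by rw [div_lt_one hS]; linarith
  have hu0 : 0 < q * (2 - s) := mul_pos hq0 hS
  have m7 : InGatedCatHull (q * s) T (2 * c + 2) (gate (blobLaw [(2 * c + 1, s / (2 - s)), (1, 1)]) (q * (2 - s))) := by
    have g := inGatedCatHull_blobLaw (s / (2 - s)) hg7 hg7' [(2 * c + 1, s / (2 - s)), (1, 1)] (fun p hp => by
      simp only [List.mem_cons, List.not_mem_nil, or_false] at hp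
      rcases hp with rfl | rfl
      · exact ⟨le_rfl, hg7'.le⟩
      · exact ⟨hg7'.le, le_rfl⟩) (M := 2 * c + 2) (by simp only [blobTop]; omega)
    have g2 := inGatedCatHull_gate g hg7.le (q * (2 - s)) hu0 hu
    have e1 : q * (2 - s) * (s / (2 - s)) = q * s := by field_simp
    have e2 : q * (2 - s) * blobMean [(2 * c + 1, s / (2 - s)), (1, 1)] = T := by
      simp only [blobMean]; push_cast; field_simp; rw [hTdef]; ring
    rwa [e1, e2] at g2
  refine InGatedCatHull.mix5
    (2 * q * (1 - s) * (1 - q - q * s) * (c + 1) / (c + 2 - T)) (q ^ 2 * (1 - s) ^ 2 * c / (c + 2 - T))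
    (2 * q * (1 - q) * s * (c + 1) / T)
    ((c + 2) * q * (1 - s) * (2 * q * s * (c + 2 - T) - 2 * (1 - q - q * s) * (T - 1) - q * (1 - s) * (T - 2)) / (T * (c + 2 - T)))
    (q * s) ?_ ?_ ?_ ?_ hy0.le ?_ m2 m4 m5 m6 m7 fun h => ?_
  · exact div_nonneg (mul_nonneg (mul_nonneg (mul_nonneg (by positivity) (by linarith)) (by nlinarith)) (by positivity)) hV.le
  · exact div_nonneg (mul_nonneg (mul_nonneg (sq_nonneg q) (sq_nonneg _)) hc0'.le) hV.le
  · exact div_nonneg (mul_nonneg (mul_nonneg (mul_nonneg (by positivity) (by linarith)) hs0.le) (by positivity)) hTpos.le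
  · refine div_nonneg (mul_nonneg (mul_nonneg (mul_nonneg (by positivity) hq0.le) (by linarith)) ?_) (mul_pos hTpos hV).le
    rw [hTdef]; linarith
  · field_simp
    rw [hTdef]
    ring
  · exact lpT_eq_bfLowMix c q s hc0 hTpos.ne' hV.ne' hS.ne' h

/-- **… hence at every floor `0 < x ≤ qs`**, with the mean written as the law's own first moment. [this work] -/
theorem lpT_inGatedCatHull_bfLow_below (c : ℕ) (q s : ℝ) (hc : 1 ≤ c) (hq : 1 / 2 < q) (hs0 : 0 < s) (hs1 : s < 1)
    (hT : 2 * q * (1 + c * s) ≤ c + 1) (hu : q * (2 - s) ≤ 1) (hw2 : q * (1 + s) ≤ 1) (hE : 2 * (1 - q) ≤ c * (q * s))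
    (hw6 : 2 * (1 - q - q * s) * (2 * q * (1 + c * s) - 1) + q * (1 - s) * (2 * q * (1 + c * s) - 2)
      ≤ 2 * q * s * (c + 2 - 2 * q * (1 + c * s))) (x : ℝ) (hx0 : 0 < x) (hx : x ≤ q * s) :
    InGatedCatHull x (∑ h ∈ Finset.range (2 * c + 2 + 1), (h : ℝ) * lpT c q s h) (2 * c + 2) (lpT c q s) := by
  rw [lpT_mean]
  exact (lpT_inGatedCatHull_bfLow c q s hc hq hs0 hs1 hT hu hw2 hE hw6).mono hx0 hx

/-- **SDEC at the natural floor** on `R_BFlow(c)`. [this work] -/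
theorem sdec_lpT_bfLow (c : ℕ) (q s : ℝ) (hc : 1 ≤ c) (hq : 1 / 2 < q) (hs0 : 0 < s) (hs1 : s < 1)
    (hT : 2 * q * (1 + c * s) ≤ c + 1) (hu : q * (2 - s) ≤ 1) (hw2 : q * (1 + s) ≤ 1) (hE : 2 * (1 - q) ≤ c * (q * s))
    (hw6 : 2 * (1 - q - q * s) * (2 * q * (1 + c * s) - 1) + q * (1 - s) * (2 * q * (1 + c * s) - 2)
      ≤ 2 * q * s * (c + 2 - 2 * q * (1 + c * s))) :
    SDEC (q * s) (2 * c + 2) (lpT c q s) :=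
  sdec_of_inGatedCatHull (mul_pos (by linarith) hs0) (lpT_inGatedCatHull_bfLow c q s hc hq hs0 hs1 hT hu hw2 hE hw6)

/-- **THE LIGHT NODE ON THESE LAWS**: every tree-built presentation `TreeBuilt x M T` at a floor `x ≤ qs` is in the hull at `x`, its own mean and
its own top. [this work] -/
theorem treeBuiltCatHull_lpT_bfLow (c : ℕ) (q s : ℝ) (hc : 1 ≤ c) (hq : 1 / 2 < q) (hs0 : 0 < s) (hs1 : s < 1)
    (hT : 2 * q * (1 + c * s) ≤ c + 1) (hu : q * (2 - s) ≤ 1) (hw2 : q * (1 + s) ≤ 1) (hE : 2 * (1 - q) ≤ c * (q * s))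
    (hw6 : 2 * (1 - q - q * s) * (2 * q * (1 + c * s) - 1) + q * (1 - s) * (2 * q * (1 + c * s) - 2)
      ≤ 2 * q * s * (c + 2 - 2 * q * (1 + c * s))) (x : ℝ) (M : ℕ) (hTB : TreeBuilt x M (lpT c q s)) (hx : x ≤ q * s) :
    InGatedCatHull x (∑ h ∈ Finset.range (M + 1), (h : ℝ) * lpT c q s h) M (lpT c q s) := by
  have hq1 : q ≤ 1 := by nlinarith
  obtain ⟨hx0, hM⟩ := lpT_treeBuilt_top c q s (by linarith) hq1 hs0 hs1.le hTB
  obtain ⟨a, rfl⟩ := Nat.exists_eq_add_of_le hM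
  rw [sum_range_extend (fun h => (h : ℝ) * lpT c q s h) (2 * c + 2) a (fun h hh => by rw [lpT_eq_zero c q s h hh, mul_zero]),
    lpT_mean]
  exact ((lpT_inGatedCatHull_bfLow c q s hc hq hs0 hs1 hT hu hw2 hE hw6).mono hx0 hx).mono_top hM

end LawDec
end Quant
end Summit.CriticalPhenomena.PercolationContinuityZ3.Theorems
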